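import Summits.Ventures.QEC.CircuitDistance.DEMCheckGen
import Summits.Ventures.QEC.CircuitDistance.SchedMono
import HarnessLib

/-!
# `[[144,12,12]]` — FAMILY-CEILING CERTIFICATES: the row format, its Boolean check and the soundness lemmas
# (venture QEC, experiment cell CDX; UPPER side only — nothing here asserts a value of `d_circ`; no landed declaration is edited)

Provenance: data and method qec-cdx-idea-2 g3 (CARD-H, `cdx/idea-2/q3/`: for every one of the 936 valid depth-7 CNOT orders —
cell numbering `cdx/idea-2/data/orders936.json`, criterion O1, RIDER L — an explicit ONE-cycle undetectable logical fault set of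
weight `d_A(class) ∈ {6, 8, 9, 10, 11}`, farm-checked there as 20 files `FamilyCeilingBB144_01–20` of 1 041–1 253 lines each);
re-typed for the tree's ≤ 400-line modules by qec-cdx-type-1 g4 (2026-08-29): the per-order data become ROWS `FamilyCert`
(schedule, residual sector, logical witness words, fault list — idea-2's fault terms verbatim), checked per chunk by ONE
`decide +kernel` over `FamilyCert.check`, whose soundness is this file. Landing authorised by director-qec R169 (3) only after
both std words ([[144]] = 10, #345 = 11) — both landed (T-106 p699378; `SchedValueBB144o345` p709149).

WHAT THIS FILE PROVES (generic in the row; the instance `S = bb144SM`, `Nc = 1` is fixed — the family lives on one code):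
* `FamilyCert.check c` := `c.faults.Nodup ∧ c.faults.length ≤ 11 ∧ Gen.undetectableW bb144SM 1 (allEventsₛ c.sched 1) c.faults
  ∧ Gen.logicalErrorW bb144SM (allEventsₛ c.sched 1) c.faults c.sector c.uL c.uR` (as one `Bool`);
* `FamilyCert.hasAt_of_check : c.check = true → HasLogicalFaultOfWeightAtMostAtₛ c.sched bb144SM 1 c.faults.length`
  (= `hasLogicalFaultAtₛ_of_checks` of `DEMCheckGen`, the witness principle of record);
* `FamilyCert.hasAt_all_of_check : … → ∀ Nc ≥ 1, HasLogicalFaultOfWeightAtMostAtₛ c.sched bb144SM Nc 11` (weight monotonicity +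
  `hasAtₛ_of_one` of `SchedMono`: one-cycle witnesses persist) and `FamilyCert.circuitDistanceₛ_le_of_check : … → ∀ Nc ≥ 1,
  circuitDistanceₛ c.sched bb144SM Nc ≤ 11`;
* the list forms `FamilyCert.forall_hasAt_of_all`, `FamilyCert.forall_le_of_all`, `FamilyCert.forall_sched_le_of_all` consumed by the
  chunk files `SchedFamilyCeiling01 …` and the binder `SchedFamilyCeiling`.
Hygiene: no `instance`, no `notation`, no `native_decide`; idea-2's DEM is not used (the check runs the SPEC semantics `allEventsₛ σ 1`).
The COMPLETENESS of the 936-list (`σ.Valid ↔ σ ∈ SMSchedule.family936`) is idea-2 g4's `SchedFamily936*` (separate modules); nothing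
in this file depends on it. Nothing here changes a deployed code.
-/

namespace Summit.Ventures.QEC.CircuitDistance

/-- A ONE-CYCLE CEILING CERTIFICATE ROW for a CNOT order of `[[144,12,12]]`: the schedule `sched`, the residual-sector flag
`sector` (`true` = `X`-type residual tested against a `Z`-type logical witness, `false` = `Z`-type residual), the logical witness
words `(uL, uR)` consumed by `Gen.logicalErrorW`, and the explicit fault list `faults` (all in cycle `1`). -/
structure FamilyCert where
  /-- the CNOT order -/
  sched : SMSchedule
  /-- residual sector flag of `Gen.logicalErrorW` -/
  sector : Bool
  /-- logical witness word, left block -/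
  uL : ℕ
  /-- logical witness word, right block -/
  uR : ℕ
  /-- the explicit one-cycle fault list -/
  faults : List (Fault 12 6)

namespace FamilyCert

/-- The Boolean CHECK of a row: duplicate-free fault list of length `≤ 11` accepted by both word-level checks of `DEMCheckGen`
run on the one-cycle event list `allEventsₛ c.sched 1` of ITS OWN order. -/
def check (c : FamilyCert) : Bool :=
  decide c.faults.Nodup && decide (c.faults.length ≤ 11) &&
    Gen.undetectableW bb144SM 1 (allEventsₛ c.sched 1) c.faults &&
    Gen.logicalErrorW bb144SM (allEventsₛ c.sched 1) c.faults c.sector c.uL c.uR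

/-- SOUNDNESS: a passing row is an undetectable logical fault set of `≤ c.faults.length` operations in the one-cycle circuit of
`c.sched` (the witness principle `hasLogicalFaultAtₛ_of_checks`). -/
theorem hasAt_of_check (c : FamilyCert) (h : c.check = true) :
    HasLogicalFaultOfWeightAtMostAtₛ c.sched bb144SM 1 c.faults.length := by
  simp only [check, Bool.and_eq_true, decide_eq_true_eq] at h
  exact hasLogicalFaultAtₛ_of_checks c.sched bb144SM 1 c.faults h.1.1.1 c.sector c.uL c.uR h.1.2 h.2

/-- A passing row has `c.faults.length ≤ 11`. -/
theorem length_le_of_check (c : FamilyCert) (h : c.check = true) : c.faults.length ≤ 11 := by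
  simp only [check, Bool.and_eq_true, decide_eq_true_eq] at h
  exact h.1.1.2

/-- Hence a set of `≤ 11` operations in the `Nc`-cycle circuit of `c.sched` for EVERY `Nc ≥ 1` (weight monotonicity, then
`hasAtₛ_of_one`: the same operations performed in the last cycle). -/
theorem hasAt_all_of_check (c : FamilyCert) (h : c.check = true) :
    ∀ Nc : ℕ, 1 ≤ Nc → HasLogicalFaultOfWeightAtMostAtₛ c.sched bb144SM Nc 11 :=
  hasAtₛ_of_one c.sched bb144SM 11
    (Gen.hasLogicalFaultOfWeightAtMostAt_mono (length_le_of_check c h) (hasAt_of_check c h))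

/-- … and `circuitDistanceₛ c.sched bb144SM Nc ≤ 11` for every `Nc ≥ 1`. -/
theorem circuitDistanceₛ_le_of_check (c : FamilyCert) (h : c.check = true) :
    ∀ Nc : ℕ, 1 ≤ Nc → circuitDistanceₛ c.sched bb144SM Nc ≤ 11 :=
  fun Nc hNc => circuitDistanceₛ_le_of_hasAt c.sched bb144SM Nc 11 (hasAt_all_of_check c h Nc hNc)

/-- LIST FORM (what a chunk's single `decide +kernel` fact yields): every row of a passing list is a one-cycle undetectable
logical set of its own length. -/
theorem forall_hasAt_of_all {cs : List FamilyCert} (h : (cs.all check) = true) :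
    ∀ c ∈ cs, HasLogicalFaultOfWeightAtMostAtₛ c.sched bb144SM 1 c.faults.length :=
  fun c hc => hasAt_of_check c (List.all_eq_true.1 h c hc)

/-- LIST FORM: `circuitDistanceₛ ≤ 11` at every `Nc ≥ 1` for every row of a passing list. -/
theorem forall_le_of_all {cs : List FamilyCert} (h : (cs.all check) = true) :
    ∀ c ∈ cs, ∀ Nc : ℕ, 1 ≤ Nc → circuitDistanceₛ c.sched bb144SM Nc ≤ 11 :=
  fun c hc => circuitDistanceₛ_le_of_check c (List.all_eq_true.1 h c hc)

/-- LIST FORM over the SCHEDULE column: `circuitDistanceₛ σ bb144SM Nc ≤ 11` for every `σ ∈ cs.map sched`, `Nc ≥ 1`. -/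
theorem forall_sched_le_of_all {cs : List FamilyCert} (h : (cs.all check) = true) :
    ∀ σ ∈ cs.map sched, ∀ Nc : ℕ, 1 ≤ Nc → circuitDistanceₛ σ bb144SM Nc ≤ 11 := by
  intro σ hσ
  obtain ⟨c, hc, rfl⟩ := List.mem_map.1 hσ
  exact forall_le_of_all h c hc

end FamilyCert

end Summit.Ventures.QEC.CircuitDistance
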